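import Literature.AnabelianGeometry.EtaleTheta.SettingModelActionContinuity
import Literature.AnabelianGeometry.EtaleTheta.SettingModelSemidirectTopology
import Literature.AnabelianGeometry.AbsoluteAnabelian.ZHatCompletionAdicCompleteness
import HarnessLib

/-!
# [AbsTopII] Def 1.2 (ii) WITH A NODE, stage S1: the Dehn-twist extension `F̂₂ ⋊_{shear^i} Ẑ`

S. Mochizuki, *Topics in Absolute Anabelian Geometry II* [AbsTopII] (bib `MochizukiAbsTopII2013`; locators =
PDF pages of the kurims manuscript `paper:url-585b8d0ad0d9`), §1, Example 1.1 / Def 1.2 (ii) p. 10: the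
DPSC-extension `1 → Π_𝔾 → Π_H = Π_𝔾 ⋊^{out} H → H → 1` of a stable log curve over a log point — here for the
DEGENERATING once-punctured curve of genus one: one vertex (the normalisation `ℙ¹ ∖ {0, 1, ∞}`), one LOOP node,
one cusp; `Π_𝔾 = F̂₂ = ⟨a, b⟩^` with `b` the VANISHING CYCLE of the node and `a` the stable letter of the loop;
the log inertia `I ≅ Ẑ` acts by the DEHN TWIST along the node, `a ↦ a·b^{k^i}`, `b ↦ b` (`i` = the speed,
which becomes the `Σ`-index `i^Σ_e` of the node, Ex 1.1 (iii)).

MODEL/CONSTRUCTION file (class (b): two defs on a NEW carrier + its topological-group instances), abc-iut-L4-t6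
lineage, row «DPSC-NODAL-MODEL» stage S1 (design memo HOME/staging/L4/abc-iut-L4-t6/gen7/MEMO-DPSC-NODAL-MODEL.md).
Everything is ASSEMBLED BY NAME from layer L2's [EtTh] §1 setting-model bricks (the Tate curve's special fibre
IS this loop-node curve): `F₂hatT`, `eta`, `bPow : ZH →ₜ* F₂hatT`, `shear k : F₂hatT ≃ₜ* F₂hatT`
(`a ↦ a·b^k`, `b ↦ b`), `shearHom : ZH →* MulAut F₂hatT` (abc-iut-L2 `SettingModelChiShear.lean`), the joint
continuity criterion `continuous_action_of_continuous_apply_eta` (`SettingModelActionContinuity.lean`) and the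
generic semidirect topology `Semidirect.*` (`SettingModelSemidirectTopology.lean`); nothing of L2 is restated.

* `DehnTwist.shearPow i : ZH →* MulAut F̂₂`, `k ↦ shear (k ^ i)` — the twist of speed `i`;
* `DehnTwist.Ext i := F̂₂ ⋊[shearPow i] ZH` with the topology induced along `(left, right)`: a compact, Hausdorff,
  totally disconnected topological group (`PiHtχq` pattern of abc-iut-w5-d249), `DehnTwist.extGrp i : ProfiniteGrp`;
* the two facts stage S3 turns into "`I_v = 1 ⋊ Ẑ`" and "`I_e ⊇ Π_e ⋊ Ẑ`": the twist FIXES the vanishing cycle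
  `b` and every `b`-power (`shearPow_bPow`), moves the stable letter by `a ↦ a·b^{k^i}` (`shearPow_eta_zero`), and
  hence fixes the second branch `a·b·a⁻¹` (`shearPow_conj_eta_one`) — so it fixes the vertex group
  `⟨b, aba⁻¹⟩^` pointwise.
HONEST FRAMING: a constructed profinite group (constructed ≠ geometric; no log scheme in the tree); the
identification with the log fundamental group of the degenerate curve is the model's honest label, not a
theorem; nothing here bears on [IUTchIII] Cor 3.12.
-/

noncomputable section

namespace Literature.AnabelianGeometry.AbsoluteAnabelian.AbsTopII.DehnTwist

open Literature.AnabelianGeometry.EtaleTheta.SettingModel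
open _root_.Topology

/-! ### The twist of speed `i` -/

/-- **The Dehn twist of speed `i`**: `k ↦ shear (k ^ i)`, `a ↦ a·b^{k^i}`, `b ↦ b` (`ZH = Ẑ` written
multiplicatively, so "`k^i`" is the `i`-th multiple). [cite: MochizukiAbsTopII2013, Ex 1.1 (iii) p.9] -/
def shearPow (i : ℕ) : ZH →* MulAut F₂hatT where
  toFun k := shearHom (k ^ i)
  map_one' := by rw [one_pow, map_one]
  map_mul' k k' := by
    have hc : Commute k k' := Literature.AnabelianGeometry.AbsoluteAnabelian.ZHatCompletion.mul_comm k k'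
    change shearHom ((k * k') ^ i) = shearHom (k ^ i) * shearHom (k' ^ i)
    rw [hc.mul_pow, map_mul]

/-- `shearPow i k x = shear (k ^ i) x`. [cite: MochizukiAbsTopII2013, Ex 1.1 (iii) p.9] -/
theorem shearPow_apply (i : ℕ) (k : ZH) (x : F₂hatT) : shearPow i k x = shear (k ^ i) x := rfl

/-- The twist fixes the vanishing cycle `b`. [cite: MochizukiAbsTopII2013, Prop 1.3 (ii) p.11] -/
theorem shearPow_eta_one (i : ℕ) (k : ZH) : shearPow i k (eta (FreeGroup.of 1)) = eta (FreeGroup.of 1) := by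
  rw [shearPow_apply, shear_apply, shearEnd_eta_of_one]

/-- The twist fixes every power `b^t` of the vanishing cycle. [cite: MochizukiAbsTopII2013, Prop 1.3 (ii) p.11] -/
theorem shearPow_bPow (i : ℕ) (k t : ZH) : shearPow i k (bPow t) = bPow t := by
  rw [shearPow_apply, shear_bPow]

/-- The twist moves the stable letter: `a ↦ a · b^{k^i}`. [cite: MochizukiAbsTopII2013, Prop 1.3 (ii) p.11] -/
theorem shearPow_eta_zero (i : ℕ) (k : ZH) :
    shearPow i k (eta (FreeGroup.of 0)) = eta (FreeGroup.of 0) * bPow (k ^ i) := by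
  rw [shearPow_apply, shear_eta_of_zero]

/-- The twist fixes the second branch `a · b · a⁻¹` of the node (conjugate of `b` by the stable letter), hence —
with `shearPow_eta_one` — the vertex group `⟨b, aba⁻¹⟩^` pointwise. [cite: MochizukiAbsTopII2013, Prop 1.3 (iii) p.11] -/
theorem shearPow_conj_eta_one (i : ℕ) (k : ZH) :
    shearPow i k (eta (FreeGroup.of 0) * eta (FreeGroup.of 1) * (eta (FreeGroup.of 0))⁻¹) =
      eta (FreeGroup.of 0) * eta (FreeGroup.of 1) * (eta (FreeGroup.of 0))⁻¹ := by
  rw [map_mul, map_mul, map_inv, shearPow_eta_zero, shearPow_eta_one]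
  -- `(a b^t) b (a b^t)⁻¹ = a b a⁻¹` since `b^t` commutes with `b`
  have hcomm : bPow (k ^ i) * eta (FreeGroup.of 1) = eta (FreeGroup.of 1) * bPow (k ^ i) := by
    rw [← bPow_iotaZ_one, ← map_mul, ← map_mul,
      Literature.AnabelianGeometry.AbsoluteAnabelian.ZHatCompletion.mul_comm]
  -- `(a · b^t) · b · (a · b^t)⁻¹ = a · (b^t b b^{-t}) · a⁻¹ = a b a⁻¹`
  calc eta (FreeGroup.of 0) * bPow (k ^ i) * eta (FreeGroup.of 1) * (eta (FreeGroup.of 0) * bPow (k ^ i))⁻¹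
      = eta (FreeGroup.of 0) * (bPow (k ^ i) * eta (FreeGroup.of 1)) * (bPow (k ^ i))⁻¹ *
          (eta (FreeGroup.of 0))⁻¹ := by group
    _ = eta (FreeGroup.of 0) * (eta (FreeGroup.of 1) * bPow (k ^ i)) * (bPow (k ^ i))⁻¹ *
          (eta (FreeGroup.of 0))⁻¹ := by rw [hcomm]
    _ = eta (FreeGroup.of 0) * eta (FreeGroup.of 1) * (eta (FreeGroup.of 0))⁻¹ := by group

/-- The twist action `(k, x) ↦ shear (k^i) x` is JOINTLY continuous (generator orbits `a·b^{k^i}` and `b` are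
continuous in `k`; L2's `continuous_action_of_continuous_apply_eta`). [cite: MochizukiAbsTopII2013, Def 1.2 (ii) p.10] -/
theorem continuous_shearPow (i : ℕ) : Continuous fun q : ZH × F₂hatT => shearPow i q.1 q.2 := by
  refine continuous_action_of_continuous_apply_eta (fun k => (shearPow i k).toMonoidHom)
    (fun k => by exact (shear (k ^ i)).continuous) ?_ ?_
  · have hfun : (fun k : ZH => (shearPow i k).toMonoidHom (eta (FreeGroup.of 0))) =
        fun k => eta (FreeGroup.of 0) * bPow (k ^ i) := funext fun k => shearPow_eta_zero i k
    rw [hfun]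
    exact continuous_const.mul (bPow.continuous.comp (continuous_pow i))
  · have hfun : (fun k : ZH => (shearPow i k).toMonoidHom (eta (FreeGroup.of 1))) =
        fun _ => eta (FreeGroup.of 1) := funext fun k => shearPow_eta_one i k
    rw [hfun]
    exact continuous_const

/-! ### The extension `Π_I := F̂₂ ⋊_{shear^i} Ẑ` -/

/-- **`Π_H = Π_I` of the nodal model**: `F̂₂ ⋊[shearPow i] ZH` — "the DPSC-extension associated to the
construction data", `H = I ≅ Ẑ` the log inertia acting by the Dehn twist of speed `i`.
[cite: MochizukiAbsTopII2013, Def 1.2 (ii) p.10] -/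
abbrev Ext (i : ℕ) : Type := F₂hatT ⋊[shearPow i] ZH

variable (i : ℕ)

/-- The topology of `Π_I`: induced along `g ↦ (g.left, g.right) ∈ F̂₂ × Ẑ`. [cite: MochizukiAbsTopII2013, Def 1.2 (ii) p.10] -/
instance instTopologicalSpaceExt : TopologicalSpace (Ext i) :=
  TopologicalSpace.induced (fun g : Ext i => (g.left, g.right)) inferInstance

/-- `g ↦ (g.left, g.right)` is inducing (by definition). [cite: MochizukiAbsTopII2013, Def 1.2 (ii) p.10] -/
theorem isInducing_leftRight : IsInducing fun g : Ext i => (g.left, g.right) := ⟨rfl⟩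

/-- `g ↦ (g.left, g.right)` is continuous. [cite: MochizukiAbsTopII2013, Def 1.2 (ii) p.10] -/
theorem continuous_leftRight : Continuous fun g : Ext i => (g.left, g.right) :=
  (isInducing_leftRight i).continuous

/-- `Π_I` is a topological group (joint continuity of the twist). [cite: MochizukiAbsTopII2013, Def 1.2 (ii) p.10] -/
instance instIsTopologicalGroupExt : IsTopologicalGroup (Ext i) :=
  Semidirect.isTopologicalGroup_of_continuous_action (isInducing_leftRight i) (continuous_shearPow i)

/-- `Π_I` is compact. [cite: MochizukiAbsTopII2013, Def 1.2 (ii) p.10] -/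
instance instCompactSpaceExt : CompactSpace (Ext i) := Semidirect.compactSpace_of (isInducing_leftRight i)

/-- `Π_I` is Hausdorff. [cite: MochizukiAbsTopII2013, Def 1.2 (ii) p.10] -/
instance instT2SpaceExt : T2Space (Ext i) := Semidirect.t2Space_of (isInducing_leftRight i)

/-- `Π_I` is totally disconnected. [cite: MochizukiAbsTopII2013, Def 1.2 (ii) p.10] -/
instance instTotallyDisconnectedSpaceExt : TotallyDisconnectedSpace (Ext i) :=
  Semidirect.totallyDisconnectedSpace_of (isInducing_leftRight i)

/-- `Π_I` as a profinite group. [cite: MochizukiAbsTopII2013, Def 1.2 (ii) p.10] -/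
def extGrp : ProfiniteGrp.{0} := ProfiniteGrp.of (Ext i)

/-- `F̂₂ ↪ Π_I`, `x ↦ (x, 1)` is continuous. [cite: MochizukiAbsTopII2013, Def 1.2 (ii) p.10] -/
theorem continuous_inl : Continuous (SemidirectProduct.inl : F₂hatT → Ext i) :=
  Semidirect.continuous_inl (isInducing_leftRight i)

/-- `Ẑ ↪ Π_I`, `k ↦ (1, k)` is continuous. [cite: MochizukiAbsTopII2013, Def 1.2 (ii) p.10] -/
theorem continuous_inr : Continuous (SemidirectProduct.inr : ZH → Ext i) :=
  Semidirect.continuous_inr (isInducing_leftRight i)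

/-- `Π_I ↠ I = Ẑ`, `g ↦ g.right`, as a continuous homomorphism. [cite: MochizukiAbsTopII2013, Def 1.2 (ii) p.10] -/
def proj : Ext i →ₜ* ZH := Semidirect.rightHomCont (isInducing_leftRight i)

/-- [cite: MochizukiAbsTopII2013, Def 1.2 (ii) p.10] -/
@[simp] theorem proj_apply (g : Ext i) : proj i g = g.right := rfl

/-- **The stable letter conjugates the twist section onto the "second branch"**: in `Π_I`,
`(a, 1)⁻¹ · (1, k) · (a, 1) = (b^{k^i}, k)` — the computation behind the BRANCH-PAIR clause of Prop 1.3 (ii)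
(`I_v = 1 ⋊ Ẑ` and its conjugate by the stable letter generate `{(b^{m i}, k)}`, of index `i` in `I_e = ⟨b⟩^ ⋊ Ẑ`).
[cite: MochizukiAbsTopII2013, Prop 1.3 (ii) p.11] -/
theorem inl_eta_zero_inv_mul_inr_mul (k : ZH) :
    (SemidirectProduct.inl (eta (FreeGroup.of 0)) : Ext i)⁻¹ * SemidirectProduct.inr k *
        SemidirectProduct.inl (eta (FreeGroup.of 0)) =
      SemidirectProduct.inl (bPow (k ^ i)) * SemidirectProduct.inr k := by
  refine SemidirectProduct.ext ?_ ?_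
  · simp only [SemidirectProduct.mul_left, SemidirectProduct.inv_left, SemidirectProduct.left_inl,
      SemidirectProduct.right_inl, SemidirectProduct.left_inr, map_one,
      MulAut.one_apply, mul_one, map_inv, SemidirectProduct.inv_right, inv_one, SemidirectProduct.mul_right,
      one_mul, SemidirectProduct.right_inr]
    rw [shearPow_eta_zero, ← mul_assoc, inv_mul_cancel, one_mul]
  · simp only [SemidirectProduct.mul_right, SemidirectProduct.inv_right, SemidirectProduct.right_inl,
      SemidirectProduct.right_inr, inv_one, one_mul, mul_one]

end Literature.AnabelianGeometry.AbsoluteAnabelian.AbsTopII.DehnTwist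

end
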